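import Literature.MathematicalPhysics.QuantumFieldTheory.Balaban1983to89.B1Eq314Proof
import Literature.MathematicalPhysics.QuantumFieldTheory.Balaban1983to89.B1Ineq351Proof
import Literature.MathematicalPhysics.QuantumFieldTheory.Balaban1983to89.B1Eq333Decomposition

/-!
# `Balaban1983to89.B1Eq333FluctuationIntegrals` — [Balaban1982Higgs1] p. 617, the sentence carrying (3.33):
*"after k successive renormalization transformations together with the corresponding translations, the field A with
which we have started in the first step is represented as A = A′^{(0),ε} + … + A′^{(k−1),ε} + A^{(k),ε} (3.33) … The
fields A′_j … are independent Gaussian random variables with the covariances C^{(j),L^jε}"* — DERIVED AS AN INTEGRAL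
IDENTITY on the tree's carrier of B1 Sect. 2 (`B1RG242.Tower`): the k-fold renormalization transformation of
`e^{−½⟨A,HA⟩}F(A)` with the translations (3.10)/(3.41) at every level IS the nested Gaussian fluctuation integral of
(3.35) p. 618 (weights `e^{−½⟨A′_j,(C^{(j)})⁻¹A′_j⟩}`, `C^{(0)} = G₁`), the integrand evaluated at the decomposition
(3.33); the case `F = 1` is (2.18)/(2.19) iterated along the chain (2.16) with the product (2.40) of the normalisations

HONEST FRAMING (cell `lit-balaban`, verbatim): statement-level skeleton of published theorems with citation tags;
proofs where landed; nothing here is a claim about the Yang–Mills mass gap.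

CITATION HEADER.  T. Bałaban, *(Higgs)₂,₃ quantum fields in a finite volume. I. A lower bound*, Commun. Math.
Phys. **85** (1982) 603–626, doi:10.1007/bf01403506 [Balaban1982Higgs1] (cell paper B1; PDF held
`paper:balaban1982-cmp85-higgs23-i`, journal page = PDF page + 602; pp. 609–612, 614, 617–619 READ AS IMAGES on the
×2 renders `run/shared/lean/pub/pub-balaban/b2b-balaban-ref1/pages/1982-cmp85-higgs23-I/…-p007…p017-x2.png`).
Unit `lit-balaban-p14` (Phase-2 proof seat p14, gen 6), HOME `run/shared/lean/pub/lit-balaban/`; SKELETON rows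
**B1.Eq3.33** (the p. 617 sentence; the algebraic decomposition is `B1Eq333Decomposition.eq333`, p243529; the
probabilistic VOCABULARY — independence of the coordinates of the product of the laws `gaussProb` — is r14's
`B1Eq333GaussianFields`, p249243; THIS file derives the product-Gaussian structure from the transformations),
**B1.Eq2.17** ((2.18)/(2.19): *"the Gaussian integral defining Z^{(k)} not typed"* — here COMPUTED along the tower),
**B1.Eq2.39** ((2.40)), **B1.Eq3.35** (the fluctuation integrals `∫dA′_{k−1} e^{−½⟨A′_{k−1},(C^{(k−1)})⁻¹A′_{k−1}⟩}⋯
∫dA′₀ e^{−½⟨A′₀,(C^{(0)})⁻¹A′₀⟩}` of (3.35), typed schematically as an abstract measure `νA` in `B1Eq365Proof.genFn335`).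

WHAT IS PRINTED (verbatim).  p. 609 [PDF 7]: *"t^ε_{a_k,L^k,A}(ψ(y),φ↾_{B^k(y)}) = (a_k(L^kε)^{d−2}/2π)^{N/2}
exp(−½a_k(L^kε)^{d−2}|ψ(y) − (Q_k(A)φ)(y)|²) (2.10) … T^{L^{k−1}ε}_{a,L,A}⋯T^{Lε}_{a,L,A}T^ε_{a,L,A} = T^ε_{a_k,L^k,A}.
(2.16)"*; p. 610 [PDF 8]: *"Z^{(k),L^kε}(Ω,A)exp(−½⟨ψ,Δ^{(k+1),L^{k+1}ε}(Ω,A)ψ⟩) = T^{L^kε}_{a,L,A}[Ω^{(k)},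
exp(−½⟨φ,Δ^{(k),L^kε}(Ω,A)φ⟩)]. (2.18) From (2.16) we have Z^ε_k(Ω,A)exp(−½⟨ψ,Δ^{(k),L^kε}(Ω,A)ψ⟩) =
T^ε_{a_k,L^k,A}[Ω,exp(−½⟨φ,(−Δ^{ε,N}_{A,Ω}+m²)φ⟩)]. (2.19)"*; p. 612 [PDF 10]: *"Z^ε_k(Ω,A) =
Z^{(k−1),L^{k−1}ε}(Ω,A)·…·Z^{(1),Lε}(Ω,A)Z^{(0),ε}(Ω,A), (2.40)"*, *"Using the identity G^ε_1(Ω,A) = C^{(0),ε}(Ω,A)"*;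
p. 614 [PDF 12]: *"The next step is the translation in the fields A  A = A′ + aL⁻²C^{(0)}Q*B =: A′ + B^{(1)} (3.10)
separating the quadratic form in the fields A, B in (3.7) into a sum of two forms … = ½⟨B,Δ^{(1),L}B⟩ +
½⟨A′,(C^{(0)})⁻¹A′⟩. (3.11)"*; p. 617 [PDF 15]: *"A^{(k),ε} = a_k(L^kε)⁻²G^ε_kQ*_kA (3.29) … At first let us notice that
after k successive renormalization transformations together with the corresponding translations, the field A with
which we have started in the first step is represented as A = A′^{(0),ε} + A′^{(1),ε} + … + A′^{(k−1),ε} + A^{(k),ε},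
(3.33) where A′^{(j),ε} are given by the formula (3.29) with A′_j instead of A. The fields A′_j defining the components
of (3.33) are independent Gaussian random variables with the covariances C^{(j),L^jε}. Also they are independent of
the field A on the L^kε-lattice, defining the configuration A^{(k),ε}."*; p. 618 [PDF 16], (3.35): *"E_k(e′,λ′,eA^{(k),ε},φ)
= −log[(a(L^kε)^{d−2}/2π)^{(d/2)|T₁^{(k)}|}·∫dA′_{k−1}exp(−½⟨A′_{k−1},(C^{(k−1),L^{k−1}ε})⁻¹A′_{k−1}⟩)·…
·(a(Lε)^{d−2}/2π)^{(d/2)|T₁^{(1)}|}∫dA′₀exp(−½⟨A′₀,(C^{(0),ε})⁻¹A′₀⟩)·T^ε_{a_k,L^k,eA^{(k),ε}+e′Σ_{j=0}^{k−1}A′^{(j),ε}}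
[…]]"*; p. 619 [PDF 17]: *"This translation has the form A = A′ + aL⁻²C^{(k)}Q*B (3.41) and it separates the quadratic
form in the fields A, B in the exponential function under the integral (3.38) into a sum of the forms
½⟨B,Δ^{(k+1),L}B⟩ + ½⟨A′,(C^{(k)})⁻¹A′⟩. In the remaining part of the action the field A occurs only through the
function A^{(k)}, … A^{(k)} = … = A′^{(k)} + B^{(k+1)}. (3.42)"*.

THE CARRIER (as in `B1Eq333Decomposition`, `B1Eq314Proof` §3, `B1RG242` §E): a tower `T : B1RG242.Tower ℝ ι` —
`ι` ↤ the sites × components of the initial lattice T_ε carrying the field A of (1.12)/(3.7) (U = 1: the vector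
field's own renormalization transformation T_{a,L}, p. 608 *"N = d, external field A = 0"*), `T.κ j` ↤ those of
T^{(j)}_{L^jε}, `T.H` ↤ −Δ^ε + m² ((1.12), = Δ^{(0),ε} (2.17)), `T.Qk j`/`T.Qks j` ↤ Q_j, Q*_j, `T.Q j`/`T.Qs j` ↤ Q, Q*
on the L^jε-lattice, `T.α j` ↤ a_j(L^jε)⁻², `T.β j` ↤ a(L^{j+1}ε)⁻², `T.G j` ↤ G^ε_j (2.20), `T.C j` ↤ C^{(j),L^jε}
(2.30), `(T.step j).Δk` ↤ Δ^{(j),L^jε} (2.21); weights `WE` (on `ι`) and `W j` (on `T.κ j`) ↤ the scalar products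
(1.5), `⟨u,v⟩_j = u ⬝ᵥ (W j *ᵥ v)` (weights (L^jε)^d in print, so that the printed site factor a(L^{j+1}ε)^{d−2}|·|² of
(2.6) is `T.β j`·⟨·,·⟩_{j+1}, cf. `B1Eq221Dictionary`); `c j` ↤ the kernel constants ((a(L^{j+1}ε)^{d−2}/2π)^{d/2})^{|T^{(j+1)}|}
of (2.5)/(2.6) (arbitrary reals here).  Level 0 → 1 uses `T.α 1` = a(Lε)⁻² (a₁ = a, p. 609) and `T.Qk 1` = Q₁ = Q,
so that `T.G 1` = (H + a(Lε)⁻²Q*Q)⁻¹ IS C^{(0),ε} (p. 612) — the tower's typing of the first step, as in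
`B1Eq333Decomposition.eq333_from_level_zero`.

WHAT THIS MODULE PROVES (0 `sorry`, axioms standard; six small `def`s — the kernel (2.6)/(2.10), the iterated
transformation, the background map (3.29), the two fluctuation weights and the nested fluctuation integral of (3.35) —
and theorems only otherwise; no `Prop`-valued definition):
* `rtIter_eq` — **THE p. 617 SENTENCE AS AN INTEGRAL IDENTITY**: for every `F : (ι → ℝ) → ℝ`, every `n` and every
  field `B` on T^{(n+1)}:  `(T^{L^nε}_{a,L}⋯T^ε_{a,L})[e^{−½⟨·,H·⟩_E}F](B)` (`rtIter`, the literal (n+1)-fold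
  composition of the Gaussian-kernel transformations) `= (∏_{j≤n} c_j)·exp(−½⟨B,Δ^{(n+1)}B⟩_{n+1})·∫dA′_n
  e^{−½⟨A′_n,(C^{(n)})⁻¹A′_n⟩_n}⋯∫dA′_1 e^{−½⟨A′_1,(C^{(1)})⁻¹A′_1⟩_1}∫dA′₀ e^{−½⟨A′₀,(C^{(0)})⁻¹A′₀⟩_E}
  F(A′₀ + Σ_{j=1}^{n}α_jG_jQ*_jA′_j + α_{n+1}G_{n+1}Q*_{n+1}B)` (`fluctInt`, nested exactly as printed in (3.35),
  `(C^{(0)})⁻¹ = H + a(Lε)⁻²P₁ = G₁⁻¹`, `(C^{(j)})⁻¹ = a(L^{j+1}ε)⁻²P + Δ^{(j)}` (2.30)) — i.e. the integrand sits at the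
  decomposition (3.33) and each A′_j carries the centred Gaussian weight of covariance C^{(j),L^jε}, independently
  (product structure) and independently of B.  PROOF = the print: induction on the number of steps; each step is the
  translation (3.10)/(3.41) under the translation-invariant `dA` (`B1Ineq351Proof.integral_gauss_translate`, which
  needs NO integrability: both sides are the same junk when divergent), the completed square (3.11)
  (`B1Eq314Proof.split311_matrix` at level 0, `split311_stepData` at the levels j ≥ 1), the consistency (2.18) ⇒ (2.21)
  one level up (`B1RG242.StepData.display221_succ`, packaged as `Δk_succ`) and the background bookkeeping (3.42)
  (`B1Eq333Decomposition.eq342_tower`).  Hypotheses: the tower relations `T.Consistent` (QQ* = 1, Q_{j+1} = QQ_j,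
  (2.13), invertibility of the arguments of G_j and C^{(j)} — over ℝ from m² > 0, `B1RG242.Tower.consistent_of_posDef`)
  and the Euclidean structure (1.5) (`ScalarProducts` at every level: adjointness of Q*_j, Q*; symmetric weights;
  H symmetric).
* `fluctInt_const`, `rtIter_one` — the case `F = 1`: `T^k[e^{−½⟨φ,Hφ⟩}](ψ) = Z_k·e^{−½⟨ψ,Δ^{(k)}ψ⟩}` with
  `Z_k = (∏c_j)·∫dA′₀e^{−½⟨A′₀,(C^{(0)})⁻¹A′₀⟩}·∏_{j=1}^{k−1}∫dA′_je^{−½⟨A′_j,(C^{(j)})⁻¹A′_j⟩}` — (2.19) with the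
  chain (2.16) on the left, and the product structure (2.40) `Z_k = Z^{(k−1)}⋯Z^{(0)}` of the normalisation.
* companion `B1Eq335FluctuationMeasure` (same seat): the NORMALISED reading — dividing by the Gaussian masses, the
  fluctuation integral is the iterated expectation against p15's probability measures `B2Eq228Conditioning.gaussProb`
  (the laws of r14's `B1Eq333GaussianFields`, whose independence statements are about exactly this product).
NOT done here: the identification of the abstract `νA` of `B1Eq365Proof.genFn335` with this nest (that file's `νA`
lives on an abstract configuration type), Fubini repackaging of the nest as ONE integral against `Measure.pi`, and
anything about the scalar field φ (the inner `T_{a_k,L^k,eA^{(k),ε}+…}[…]` of (3.35) is the `F` here).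
-/

namespace Literature.MathematicalPhysics.QuantumFieldTheory.Balaban1983to89.B1Eq333FluctuationIntegrals

open Literature.MathematicalPhysics.QuantumFieldTheory.Balaban1983to89
open MeasureTheory Matrix B1RG242 B1RG242.StepData B1Sect3Statements

/-! ## 1. The objects: Gaussian kernels (2.6)/(2.10) with U = 1, the iterated transformation, the backgrounds (3.29),
the fluctuation weights of (3.35) and the nested fluctuation integral -/

section Defs

variable {X Y : Type} [Fintype X] [Fintype Y]

/-- The renormalization kernel (2.5)–(2.6)/(2.10) for the vector field itself (U = 1, p. 608 *"N = d, external field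
A = 0"*), all sites collected into one exponential: `t(B,A) = c·exp(−½κ⟨B − QA, B − QA⟩_M)` with `κ` ↤ a(L^{k+1}ε)⁻²
(resp. a_k(L^kε)⁻²), `Q` ↤ the block average, `⟨u,v⟩_M = u ⬝ᵥ (W_M *ᵥ v)` the scalar product (1.5) of the coarse
lattice and `c` ↤ the constant `((κ′/2π)^{N/2})^{|sites|}`. [cite: Balaban1982Higgs1, (2.6) p.608, (2.10) p.609] -/
noncomputable def rtKernel (c κ : ℝ) (WM : Matrix Y Y ℝ) (Q : Matrix Y X ℝ) (B : Y → ℝ) (A : X → ℝ) : ℝ :=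
  c * Real.exp (-(1 / 2 * κ * ((B - Q *ᵥ A) ⬝ᵥ (WM *ᵥ (B - Q *ᵥ A)))))

end Defs

variable {ι : Type} [Fintype ι] [DecidableEq ι] (T : B1RG242.Tower ℝ ι)
  (WE : Matrix ι ι ℝ) (W : ∀ j, Matrix (T.κ j) (T.κ j) ℝ) (c : ℕ → ℝ)

/-- **The iterated renormalization transformation** (the chain (2.16) applied to the density `e^{−½⟨A,HA⟩_E}F(A)` of
(1.12)/(3.7), vector-field part): `rtIter F n` is the density on the fields `B : T^{(n+1)} → ℝ` after `n + 1` steps —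
step 0 → 1 with the kernel `c₀e^{−½a(Lε)⁻²⟨B − Q₁A,·⟩₁}` (a₁ = a, Q₁ = Q), step j → j+1 (j ≥ 1) with
`c_je^{−½a(L^{j+1}ε)⁻²⟨B − QA_j,·⟩_{j+1}}`; `dA` = Lebesgue measure (p. 605).
[cite: Balaban1982Higgs1, (2.4)–(2.6) p.608, (2.16) p.609] -/
noncomputable def rtIter (F : (ι → ℝ) → ℝ) : (n : ℕ) → (T.κ (n + 1) → ℝ) → ℝ
  | 0 => fun B => ∫ A : ι → ℝ,
      rtKernel (c 0) (T.α 1) (W 1) (T.Qk 1) B A * (Real.exp (-(1 / 2 * (A ⬝ᵥ (WE *ᵥ (T.H *ᵥ A))))) * F A)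
  | n + 1 => fun B => ∫ A : T.κ (n + 1) → ℝ,
      rtKernel (c (n + 1)) (T.β (n + 1)) (W (n + 1 + 1)) (T.Q (n + 1)) B A * rtIter F n A

/-- The level-j background map `X ↦ α_jG^ε_jQ*_jX` of (3.29) (unit-lattice constants; `A^{(j),ε}[X]`, and for a
fluctuation field `A′^{(j),ε} = α_jG_jQ*_jA′_j`, p. 617). [cite: Balaban1982Higgs1, (3.29) p.617] -/
noncomputable def bg (j : ℕ) (X : T.κ j → ℝ) : ι → ℝ := T.α j • ((T.G j * T.Qks j) *ᵥ X)

/-- The level-0 fluctuation weight of (3.35): `exp(−½⟨A′₀,(C^{(0),ε})⁻¹A′₀⟩_E)` with `(C^{(0),ε})⁻¹ = a(Lε)⁻²Q*Q +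
(−Δ^ε + m²) = (G^ε_1)⁻¹` (*"the identity G^ε_1 = C^{(0),ε}"*, p. 612; (2.20)/(2.31)).
[cite: Balaban1982Higgs1, (3.35) p.618] -/
noncomputable def flW₀ (A' : ι → ℝ) : ℝ :=
  Real.exp (-(1 / 2 * (A' ⬝ᵥ (WE *ᵥ ((T.α 1 • (T.Qks 1 * T.Qk 1) + T.H) *ᵥ A')))))

/-- The level-j fluctuation weight of (3.35) (j ≥ 1): `exp(−½⟨A′_j,(C^{(j),L^jε})⁻¹A′_j⟩_j)` with `(C^{(j),L^jε})⁻¹ =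
a(L^{j+1}ε)⁻²P + Δ^{(j),L^jε}` (2.30). [cite: Balaban1982Higgs1, (3.35) p.618] -/
noncomputable def flW (j : ℕ) (A' : T.κ j → ℝ) : ℝ :=
  Real.exp (-(1 / 2 * (A' ⬝ᵥ (W j *ᵥ (((T.step j).β • (T.step j).P + (T.step j).Δk) *ᵥ A')))))

/-- **The nested fluctuation integral of (3.35)** over the levels `1, …, n` (level `n` outermost, as printed):
`fluctInt Φ n v = ∫dA′_n e^{−½⟨A′_n,(C^{(n)})⁻¹A′_n⟩}⋯∫dA′_1 e^{−½⟨A′_1,(C^{(1)})⁻¹A′_1⟩} Φ(v + α_nG_nQ*_nA′_n + … +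
α₁G₁Q*₁A′_1)`; the level-0 integral `∫dA′₀ e^{−½⟨A′₀,(C^{(0)})⁻¹A′₀⟩}F(A′₀ + ·)` is the innermost functional `Φ`
(`rtIter_eq`). [cite: Balaban1982Higgs1, (3.35) p.618] -/
noncomputable def fluctInt (Φ : (ι → ℝ) → ℝ) : ℕ → (ι → ℝ) → ℝ
  | 0 => Φ
  | n + 1 => fun v => ∫ A' : T.κ (n + 1) → ℝ, flW T W (n + 1) A' * fluctInt Φ n (v + bg T (n + 1) A')

/-! ## 2. Tower bookkeeping: (2.18) ⇒ (2.21) one level up, and (3.42) -/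

/-- (2.18) defines Δ^{(j+1)} as the Schur complement `β_j·1 − β_j²·QC^{(j)}Q*` of the j-th step form; along a
consistent tower this IS the (2.21)-operator of level j + 1 (`display221_succ` + Q_{j+1} = QQ_j, Q*_{j+1} = Q*_jQ*,
(2.13)). [cite: Balaban1982Higgs1, (2.18)/(2.21) p.610] -/
theorem Δk_succ (h : T.Consistent) (j : ℕ) (hj : 1 ≤ j) :
    (T.step (j + 1)).Δk
      = T.β j • (1 : Matrix (T.κ (j + 1)) (T.κ (j + 1)) ℝ) - T.β j ^ 2 • (T.Q j * T.C j * T.Qs j) := by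
  obtain ⟨hG1, hQ1, hα1⟩ := B1Eq333Decomposition.tower_next T h j hj
  have h221 := (T.step j).display221_succ (h.QQs j hj) (h.αβ_ne j hj) (h.G_arg j hj) (h.C_arg j hj)
  have eΔ : (T.step (j + 1)).Δk
      = T.α (j + 1) • (1 : Matrix (T.κ (j + 1)) (T.κ (j + 1)) ℝ)
        - T.α (j + 1) ^ 2 • (T.Qk (j + 1) * T.G (j + 1) * T.Qks (j + 1)) := rfl
  rw [eΔ, hG1, hQ1, hα1, h.Qk_succ j hj]
  exact h221.symm

/-- (3.42) for the background maps: `bg_j(A′ + β_jC^{(j)}Q*X) = bg_j A′ + bg_{j+1} X` (= `eq342_tower`).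
[cite: Balaban1982Higgs1, (3.42) p.619] -/
theorem bg_transl (h : T.Consistent) (j : ℕ) (hj : 1 ≤ j) (A' : T.κ j → ℝ) (X : T.κ (j + 1) → ℝ) :
    bg T j (A' + T.β j • (T.C j *ᵥ (T.Qs j *ᵥ X))) = bg T j A' + bg T (j + 1) X :=
  B1Eq333Decomposition.eq342_tower T h j hj A' X

/-! ## 3. One step under the integral: translation (3.10)/(3.41) + completed square (3.11) -/

section OneStep

variable {X Y : Type} [Fintype X] [Fintype Y]

/-- Collecting the kernel and a Gaussian density factor into one exponential: `c·e^{−½κ⟨B−QA,·⟩}·(e^{−½⟨A,DA⟩_K}·g) =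
c·(e^{−q(A,B)}·g)` with `q(A,B) = ½κ⟨B − QA,B − QA⟩_M + ½⟨A,DA⟩_K` — the quadratic form "in the fields A, B" of (3.7)/(3.38).
[cite: Balaban1982Higgs1, (3.7) p.613] -/
theorem rtKernel_mul_exp (c κ : ℝ) (WM : Matrix Y Y ℝ) (Q : Matrix Y X ℝ) (WK D : Matrix X X ℝ) (B : Y → ℝ)
    (A : X → ℝ) (g : ℝ) :
    rtKernel c κ WM Q B A * (Real.exp (-(1 / 2 * (A ⬝ᵥ (WK *ᵥ (D *ᵥ A))))) * g)
      = c * (Real.exp (-(1 / 2 * κ * ((B - Q *ᵥ A) ⬝ᵥ (WM *ᵥ (B - Q *ᵥ A)))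
          + 1 / 2 * (A ⬝ᵥ (WK *ᵥ (D *ᵥ A))))) * g) := by
  rw [rtKernel, neg_add, Real.exp_add]
  ring

/-- **One renormalization step with the translation, under the integral** (the mechanism of (2.18), of (3.7) ⇒ (3.11)
and of (3.38) ⇒ (3.41)/(3.42)): if the step form splits under `A = A′ + κ·CQ*B` (`Split311`), then for EVERY factor
`Φ`, `∫dA c·e^{−½κ⟨B−QA,·⟩_M}·e^{−½⟨A,DA⟩_K}·Φ(A) = c·e^{−qB(B)}·∫dA′ e^{−qA′(A′)}·Φ(A′ + κ·CQ*B)` — no integrability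
needed (`B1Ineq351Proof.integral_gauss_translate`). [cite: Balaban1982Higgs1, (3.41) p.619] -/
theorem integral_rtKernel_step (c κ : ℝ) (WM : Matrix Y Y ℝ) (Q : Matrix Y X ℝ) (Qs : Matrix X Y ℝ)
    (WK D C : Matrix X X ℝ) {qB : (Y → ℝ) → ℝ} {qA' : (X → ℝ) → ℝ}
    (hsplit : Split311 κ C.mulVecLin Qs.mulVecLin
      (fun A B => 1 / 2 * κ * ((B - Q *ᵥ A) ⬝ᵥ (WM *ᵥ (B - Q *ᵥ A))) + 1 / 2 * (A ⬝ᵥ (WK *ᵥ (D *ᵥ A))))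
      qB qA')
    (Φ : (X → ℝ) → ℝ) (B : Y → ℝ) :
    ∫ A : X → ℝ, rtKernel c κ WM Q B A * (Real.exp (-(1 / 2 * (A ⬝ᵥ (WK *ᵥ (D *ᵥ A))))) * Φ A)
      = c * (Real.exp (-qB B) * ∫ A' : X → ℝ, Real.exp (-qA' A') * Φ (A' + κ • (C *ᵥ (Qs *ᵥ B)))) := by
  have key := B1Ineq351Proof.integral_gauss_translate (volume : Measure (X → ℝ)) hsplit B Φ
  simp only [transl310, Matrix.mulVecLin_apply] at key
  simp_rw [rtKernel_mul_exp]
  rw [integral_const_mul, key]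

end OneStep

/-! ## 4. The main theorem: k steps = the nested Gaussian fluctuation integrals, integrand at (3.33) -/

section Main

variable {T WE W}

/-- The completed square (3.11) at level 0 on the tower: with `⟨·,·⟩_E`, `⟨·,·⟩₁` the scalar products (1.5) (Q*₁ the
adjoint of Q₁, H symmetric, `W 1` symmetric) and G₁ a genuine inverse, `½α₁⟨B − Q₁A,·⟩₁ + ½⟨A,HA⟩_E` at
`A = A′ + α₁G₁Q*₁B` equals `½⟨B,Δ^{(1)}B⟩₁ + ½⟨A′,(α₁Q*₁Q₁ + H)A′⟩_E` (`B1Eq314Proof.split311_matrix`; G₁ = C^{(0)}).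
[cite: Balaban1982Higgs1, (3.11) p.614] -/
theorem split_level_zero (h : T.Consistent) (E1 : (T.step 1).ScalarProducts WE (W 1) (W (1 + 1)))
    (symW1 : ∀ u v : T.κ 1 → ℝ, u ⬝ᵥ (W 1 *ᵥ v) = v ⬝ᵥ (W 1 *ᵥ u))
    (symH : ∀ φ ψ : ι → ℝ, φ ⬝ᵥ (WE *ᵥ (T.H *ᵥ ψ)) = ψ ⬝ᵥ (WE *ᵥ (T.H *ᵥ φ))) :
    Split311 (T.α 1) (T.G 1).mulVecLin (T.Qks 1).mulVecLin
      (fun A B => 1 / 2 * T.α 1 * ((B - T.Qk 1 *ᵥ A) ⬝ᵥ (W 1 *ᵥ (B - T.Qk 1 *ᵥ A)))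
        + 1 / 2 * (A ⬝ᵥ (WE *ᵥ (T.H *ᵥ A))))
      (fun B => 1 / 2 * (B ⬝ᵥ (W 1 *ᵥ ((T.step 1).Δk *ᵥ B))))
      (fun A' => 1 / 2 * (A' ⬝ᵥ (WE *ᵥ ((T.α 1 • (T.Qks 1 * T.Qk 1) + T.H) *ᵥ A')))) := by
  have hGmul : (T.α 1 • (T.Qks 1 * T.Qk 1) + T.H) * T.G 1 = 1 := by
    rw [add_comm]
    exact (T.step 1).Gk_mul (h.G_arg 1 le_rfl)
  exact B1Eq314Proof.split311_matrix WE (W 1) symW1 (T.α 1) (T.Qk 1) (T.Qks 1) E1.adjk T.H symH (T.G 1) hGmul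

/-- The completed square (3.11)/(3.41) at a level j ≥ 1 on the tower, with the B-form ALREADY read as
`½⟨B,Δ^{(j+1)}B⟩_{j+1}` ((2.18) ⇒ (2.21), `Δk_succ`) and `(C^{(j)})⁻¹ = β_jP + Δ^{(j)}`
(`B1Eq314Proof.split311_stepData`, symmetry of Δ^{(j)} from `stepData_Δk_symm`). [cite: Balaban1982Higgs1, (3.41) p.619] -/
theorem split_level_succ (h : T.Consistent) (j : ℕ) (hj : 1 ≤ j)
    (Ej : (T.step j).ScalarProducts WE (W j) (W (j + 1)))
    (symE : ∀ φ ψ : ι → ℝ, φ ⬝ᵥ (WE *ᵥ ψ) = ψ ⬝ᵥ (WE *ᵥ φ))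
    (symWj : ∀ u v : T.κ j → ℝ, u ⬝ᵥ (W j *ᵥ v) = v ⬝ᵥ (W j *ᵥ u))
    (symWj1 : ∀ u v : T.κ (j + 1) → ℝ, u ⬝ᵥ (W (j + 1) *ᵥ v) = v ⬝ᵥ (W (j + 1) *ᵥ u))
    (symH : ∀ φ ψ : ι → ℝ, φ ⬝ᵥ (WE *ᵥ (T.H *ᵥ ψ)) = ψ ⬝ᵥ (WE *ᵥ (T.H *ᵥ φ))) :
    Split311 (T.β j) (T.C j).mulVecLin (T.Qs j).mulVecLin
      (fun A B => 1 / 2 * T.β j * ((B - T.Q j *ᵥ A) ⬝ᵥ (W (j + 1) *ᵥ (B - T.Q j *ᵥ A)))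
        + 1 / 2 * (A ⬝ᵥ (W j *ᵥ ((T.step j).Δk *ᵥ A))))
      (fun B => 1 / 2 * (B ⬝ᵥ (W (j + 1) *ᵥ ((T.step (j + 1)).Δk *ᵥ B))))
      (fun A' => 1 / 2 * (A' ⬝ᵥ (W j *ᵥ (((T.step j).β • (T.step j).P + (T.step j).Δk) *ᵥ A')))) := by
  have symΔ := B1Eq314Proof.stepData_Δk_symm (T.step j) symE symWj symH Ej.adjk (h.G_arg j hj)
  have hs := B1Eq314Proof.split311_stepData (T.step j) (W j) (W (j + 1)) symWj1 Ej.adj symΔ (h.C_arg j hj)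
  rw [Δk_succ T h j hj]
  exact hs

/-- **The p. 617 sentence of (3.33), DERIVED**: after `n + 1` renormalization transformations (levels 0 → 1 → ⋯ →
n + 1) together with the translations (3.10)/(3.41) at every level, the transformed density at `B` is
`(∏_{j≤n}c_j)·e^{−½⟨B,Δ^{(n+1)}B⟩_{n+1}}` times the nested Gaussian fluctuation integral of (3.35) — `A′_n, …, A′_1, A′₀`
integrated against `e^{−½⟨A′_j,(C^{(j)})⁻¹A′_j⟩}dA′_j` (centred Gaussian weights with the covariances C^{(j),L^jε},
a PRODUCT structure: "independent", and free of `B`: "independent of the field A on the L^kε-lattice") — of the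
original integrand `F` evaluated at the decomposition (3.33), `A = A′₀ + Σ_{j=1}^{n}α_jG_jQ*_jA′_j +
α_{n+1}G_{n+1}Q*_{n+1}B`.  Valid for every `F` (no integrability hypotheses: translation invariance of `dA` only).
[cite: Balaban1982Higgs1, (3.33) p.617] -/
theorem rtIter_eq (h : T.Consistent) (E : ∀ j, 1 ≤ j → (T.step j).ScalarProducts WE (W j) (W (j + 1)))
    (symE : ∀ φ ψ : ι → ℝ, φ ⬝ᵥ (WE *ᵥ ψ) = ψ ⬝ᵥ (WE *ᵥ φ))
    (symW : ∀ j, 1 ≤ j → ∀ u v : T.κ j → ℝ, u ⬝ᵥ (W j *ᵥ v) = v ⬝ᵥ (W j *ᵥ u))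
    (symH : ∀ φ ψ : ι → ℝ, φ ⬝ᵥ (WE *ᵥ (T.H *ᵥ ψ)) = ψ ⬝ᵥ (WE *ᵥ (T.H *ᵥ φ)))
    (F : (ι → ℝ) → ℝ) (n : ℕ) (B : T.κ (n + 1) → ℝ) :
    rtIter T WE W c F n B
      = (∏ j ∈ Finset.range (n + 1), c j)
        * (Real.exp (-(1 / 2 * (B ⬝ᵥ (W (n + 1) *ᵥ ((T.step (n + 1)).Δk *ᵥ B)))))
          * fluctInt T W (fun v => ∫ A' : ι → ℝ, flW₀ T WE A' * F (A' + v)) n (bg T (n + 1) B)) := by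
  induction n with
  | zero =>
      -- the first step (3.10)/(3.11): G₁ = C^{(0)}
      have hsplit := split_level_zero h (E 1 le_rfl) (symW 1 le_rfl) symH
      have step := integral_rtKernel_step (c 0) (T.α 1) (W 1) (T.Qk 1) (T.Qks 1) WE T.H (T.G 1) hsplit F B
      rw [Finset.prod_range_one]
      show (∫ A : ι → ℝ, rtKernel (c 0) (T.α 1) (W 1) (T.Qk 1) B A
          * (Real.exp (-(1 / 2 * (A ⬝ᵥ (WE *ᵥ (T.H *ᵥ A))))) * F A)) = _
      rw [step]
      congr 2
      show (∫ A' : ι → ℝ, Real.exp (-(1 / 2 * (A' ⬝ᵥ (WE *ᵥ ((T.α 1 • (T.Qks 1 * T.Qk 1) + T.H) *ᵥ A')))))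
          * F (A' + T.α 1 • (T.G 1 *ᵥ (T.Qks 1 *ᵥ B))))
        = ∫ A' : ι → ℝ, flW₀ T WE A' * F (A' + bg T 1 B)
      simp only [flW₀, bg, Matrix.mulVec_mulVec]
  | succ n ih =>
      -- the step n+1 → n+2: (3.41)/(3.42) with Δ^{(n+2)} from (2.18)
      have hn : 1 ≤ n + 1 := Nat.succ_pos n
      have hsplit := split_level_succ h (n + 1) hn (E (n + 1) hn) symE (symW (n + 1) hn)
        (symW (n + 1 + 1) (Nat.succ_pos _)) symH
      -- rewrite the previous density by the induction hypothesis, pull the constant out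
      have eI : rtIter T WE W c F (n + 1) B
          = ∫ A : T.κ (n + 1) → ℝ, rtKernel (c (n + 1)) (T.β (n + 1)) (W (n + 1 + 1)) (T.Q (n + 1)) B A
              * rtIter T WE W c F n A := rfl
      rw [eI]
      simp_rw [ih]
      have epull : ∀ A : T.κ (n + 1) → ℝ,
          rtKernel (c (n + 1)) (T.β (n + 1)) (W (n + 1 + 1)) (T.Q (n + 1)) B A
            * ((∏ j ∈ Finset.range (n + 1), c j)
              * (Real.exp (-(1 / 2 * (A ⬝ᵥ (W (n + 1) *ᵥ ((T.step (n + 1)).Δk *ᵥ A)))))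
                * fluctInt T W (fun v => ∫ A' : ι → ℝ, flW₀ T WE A' * F (A' + v)) n (bg T (n + 1) A)))
          = (∏ j ∈ Finset.range (n + 1), c j)
            * (rtKernel (c (n + 1)) (T.β (n + 1)) (W (n + 1 + 1)) (T.Q (n + 1)) B A
              * (Real.exp (-(1 / 2 * (A ⬝ᵥ (W (n + 1) *ᵥ ((T.step (n + 1)).Δk *ᵥ A)))))
                * fluctInt T W (fun v => ∫ A' : ι → ℝ, flW₀ T WE A' * F (A' + v)) n (bg T (n + 1) A))) :=
        fun A => by ring
      simp_rw [epull]
      rw [integral_const_mul,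
        integral_rtKernel_step (c (n + 1)) (T.β (n + 1)) (W (n + 1 + 1)) (T.Q (n + 1)) (T.Qs (n + 1))
          (W (n + 1)) (T.step (n + 1)).Δk (T.C (n + 1)) hsplit _ B,
        Finset.prod_range_succ c (n + 1)]
      -- the translated background (3.42) and the nest one level up
      have enest : (∫ A' : T.κ (n + 1) → ℝ,
            Real.exp (-(1 / 2 * (A' ⬝ᵥ (W (n + 1) *ᵥ
              (((T.step (n + 1)).β • (T.step (n + 1)).P + (T.step (n + 1)).Δk) *ᵥ A')))))
            * fluctInt T W (fun v => ∫ A'' : ι → ℝ, flW₀ T WE A'' * F (A'' + v)) n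
                (bg T (n + 1) (A' + T.β (n + 1) • (T.C (n + 1) *ᵥ (T.Qs (n + 1) *ᵥ B)))))
          = fluctInt T W (fun v => ∫ A'' : ι → ℝ, flW₀ T WE A'' * F (A'' + v)) (n + 1) (bg T (n + 1 + 1) B) := by
        show _ = ∫ A' : T.κ (n + 1) → ℝ, flW T W (n + 1) A'
            * fluctInt T W (fun v => ∫ A'' : ι → ℝ, flW₀ T WE A'' * F (A'' + v)) n
                (bg T (n + 1 + 1) B + bg T (n + 1) A')
        refine integral_congr_ae (Filter.Eventually.of_forall fun A' => ?_)
        dsimp only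
        rw [bg_transl T h (n + 1) hn A' B, add_comm (bg T (n + 1) A')]
        rfl
      rw [enest]
      ring

end Main

/-! ## 5. `F = 1`: (2.18)/(2.19) along the chain (2.16) and the product (2.40) of the normalisations -/

section Constants

variable {T W}

/-- The nest of a CONSTANT functional is the constant times the product of the Gaussian masses of the levels:
`fluctInt K n v = K·∏_{j=1}^{n}∫dA′_je^{−½⟨A′_j,(C^{(j)})⁻¹A′_j⟩}` (no integrability needed: a divergent level gives the
junk `0` on both sides). [cite: Balaban1982Higgs1, (2.40) p.612] -/
theorem fluctInt_const (K : ℝ) (n : ℕ) (v : ι → ℝ) :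
    fluctInt T W (fun _ => K) n v = K * ∏ j ∈ Finset.Icc 1 n, ∫ A' : T.κ j → ℝ, flW T W j A' := by
  induction n generalizing v with
  | zero => simp [fluctInt]
  | succ n ih =>
      show (∫ A' : T.κ (n + 1) → ℝ, flW T W (n + 1) A' * fluctInt T W (fun _ => K) n (v + bg T (n + 1) A')) = _
      simp_rw [ih]
      rw [integral_mul_const, Finset.prod_Icc_succ_top (Nat.le_add_left 1 n)]
      ring

/-- The nest is linear in the innermost functional: a constant factor pulls out of all the levels.
[cite: Balaban1982Higgs1, (3.35) p.618] -/
theorem fluctInt_const_mul (K : ℝ) (Ψ : (ι → ℝ) → ℝ) (n : ℕ) (v : ι → ℝ) :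
    fluctInt T W (fun w => K * Ψ w) n v = K * fluctInt T W Ψ n v := by
  induction n generalizing v with
  | zero => rfl
  | succ n ih =>
      show (∫ A' : T.κ (n + 1) → ℝ, flW T W (n + 1) A' * fluctInt T W (fun w => K * Ψ w) n (v + bg T (n + 1) A')) = _
      simp_rw [ih]
      have e : ∀ A' : T.κ (n + 1) → ℝ, flW T W (n + 1) A' * (K * fluctInt T W Ψ n (v + bg T (n + 1) A'))
          = K * (flW T W (n + 1) A' * fluctInt T W Ψ n (v + bg T (n + 1) A')) := fun A' => by ring
      simp_rw [e]
      rw [integral_const_mul]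
      rfl

variable {WE}

/-- **(2.19) along the chain (2.16), with (2.40)**: the (k = n+1)-fold transformation of the pure Gaussian
`e^{−½⟨φ,Hφ⟩}` is `Z_k·e^{−½⟨ψ,Δ^{(k)}ψ⟩}` with the normalisation factorised over the levels,
`Z_k = (∏_{j<k}c_j)·∫dA′₀e^{−½⟨A′₀,(C^{(0)})⁻¹A′₀⟩}·∏_{j=1}^{k−1}∫dA′_je^{−½⟨A′_j,(C^{(j)})⁻¹A′_j⟩}` — *"Z^ε_k =
Z^{(k−1),L^{k−1}ε}⋯Z^{(1),Lε}Z^{(0),ε} (2.40)"* (each level contributes its own constant times Gaussian mass).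
[cite: Balaban1982Higgs1, (2.19) p.610, (2.40) p.612] -/
theorem rtIter_one (h : T.Consistent) (E : ∀ j, 1 ≤ j → (T.step j).ScalarProducts WE (W j) (W (j + 1)))
    (symE : ∀ φ ψ : ι → ℝ, φ ⬝ᵥ (WE *ᵥ ψ) = ψ ⬝ᵥ (WE *ᵥ φ))
    (symW : ∀ j, 1 ≤ j → ∀ u v : T.κ j → ℝ, u ⬝ᵥ (W j *ᵥ v) = v ⬝ᵥ (W j *ᵥ u))
    (symH : ∀ φ ψ : ι → ℝ, φ ⬝ᵥ (WE *ᵥ (T.H *ᵥ ψ)) = ψ ⬝ᵥ (WE *ᵥ (T.H *ᵥ φ)))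
    (n : ℕ) (B : T.κ (n + 1) → ℝ) :
    rtIter T WE W c (fun _ => 1) n B
      = ((∏ j ∈ Finset.range (n + 1), c j) * ((∫ A' : ι → ℝ, flW₀ T WE A')
          * ∏ j ∈ Finset.Icc 1 n, ∫ A' : T.κ j → ℝ, flW T W j A'))
        * Real.exp (-(1 / 2 * (B ⬝ᵥ (W (n + 1) *ᵥ ((T.step (n + 1)).Δk *ᵥ B))))) := by
  rw [rtIter_eq c h E symE symW symH (fun _ => 1) n B]
  have e0 : (fun v : ι → ℝ => ∫ A' : ι → ℝ, flW₀ T WE A' * (1 : ℝ)) = fun _ => ∫ A' : ι → ℝ, flW₀ T WE A' := by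
    funext v
    simp only [mul_one]
  rw [e0, fluctInt_const]
  ring

end Constants

end Literature.MathematicalPhysics.QuantumFieldTheory.Balaban1983to89.B1Eq333FluctuationIntegrals
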